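import Summits.QuantumFields.YangMills.Theorems.UnitScaleTiltProp7CurvedLandauCoreLinearSubspaceT3
import Summits.QuantumFields.YangMills.Theorems.UnitScaleTiltProp7CentreHarmonicDivEngine
import Summits.QuantumFields.YangMills.Theorems.UnitScaleTiltProp7CentreHarmonicDivDictionary
import Literature.MathematicalPhysics.QuantumFieldTheory.Balaban1983to89.T3DescentFibreTower
import Literature.MathematicalPhysics.QuantumFieldTheory.Balaban1983to89.BlockAveragingEMLAnalyticMean
import Literature.MathematicalPhysics.QuantumFieldTheory.Balaban1983to89.Node00.WilsonActionFirstVariationCoDiv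
import HarnessLib

/-!
# Route `UnitScaleTilt`, crux K1 «MinimiserStabilityRegPr» (stmt-QuantumFields-19200), route-R E′ S3 ∕ line «HKGK-ANALYTIC» (C6) —
# THE FLAT HESS-K ON `V = S_H ∩ ker Q` AT `W = 1`, BY KERNEL: `(1∕2)·ℓ⁻²·Σ_b‖Y(b)‖² ≤ (18 + 76800L⁴)·(1 + ζ_H)·Σ_p‖(∂Y)(p)‖²_F`
# for every bond field `Y` with `Q^{(K−n)}Y = 0` and `Δ(∂^*Y) = 0` off the `(K−n)`-centres, GIVEN LEMMA H (displayed as in ✓`Prop7CentreHarmonicDivEngine`)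

Cell `ym3-torus`, twin-width seat `ym-ust-19936-w8` (gen 5); ★★OWNER ym3-torus-plan g28 interim E′ word 2026-08-28T22:42:33Z (line HKGK-ANALYTIC (C1)–(C7),
pen ★ym-ust-19200-w4 g7; LOCATE-B1-BERNSTEIN §0.5 (C6)).  THEOREMS ONLY (0 `def`, 0 `sorry`); `--supports stmt-QuantumFields-19200 --as helper`, count-neutral.
YM₃ on T³ is a ladder rung (R3), not the Clay problem; nothing here claims S3, hKg-K, E′, the stub, the crux, d = 4 or the mass gap.

WHY.  The HKGK line's two-sided law (★w4-19200 g7, `LOCATE-RB-HKGK-MECHANISM` §0.3) divides by `κ := inf_V ℓ²‖curl Y‖²∕‖Y‖²` on the FLAT LINEAR space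
`V := S_H ∩ ker Q` at `W = 1`; LOCATE-B1 §0.5 lists (C6) as «✓(116)-core ∘ ✓p652867».  The (116)-core ✓`Prop7HessWOfFibreCoreT3.hessW_curl_div_of_fibre_T3` speaks of chart
points ON THE EXACT NONLINEAR (0.4)-fibre, and the linear N8 ✓`Prop7PinnedFlatCoercivityInhom` carries `(L^k)³` on the off-centre divergence, so neither composes to a
k-uniform `κ` on the linear `V`.  The right LINEAR supplier is ✓`Prop7CurvedLandauCoreLinearSubspaceT3.linearised_subspace_core_budget_T3` (★routeR-w3 g2) read AT THE FLAT
BACKGROUND `U₀ = 1` with `δ := 0`, `Z := DIV`, `Z_Q := 0`: `(1∕2)ℓ⁻²·Σ‖Y‖² ≤ (18 + 76800L⁴)·(K_HS + DIV_HS)` for every `Y ∈ ker Q^{(K−n)}_1` — full divergence, no `ℓ³`.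
This file (i) identifies, at `U₀ = 1`, the true linearised recursion of record with the tree's `linAvg`-composite and the covariant curl∕divergence of `B9Eq39Adjoint` with
`LatticeFieldCalculus.curl 1`∕`diverg 1` (pure bookkeeping), (ii) states the flat core on `ker Q` in those letters, and (iii) composes with the flat ζ-row ✓p652867
`Prop7CentreHarmonicDivEngine.sum_diverg_normSq_le_curl_normSq_of_centreHarmonic_T3` (`DIV ≤ ζ_H·K` on `S_H`, LEMMA H displayed) to the HESS-K on `V`.

WHAT IS PROVED (ns `…Theorems.Prop7FlatHessKOnSlice`; `d = 3`, `SU(2)`, run `K` of a T³ family, comparison height `n`, `ℓ = L^{K−n}`):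
* §1 flat dictionary: `unitsField_toUField_one`, `curl_torusT_one_eq`, `divB_torusT_one_eq`, `sum_curlHS_one_eq_sum_plaq_normSq` (via ✓`Node00.sum_plaq_eq_sum_site`), `sum_divBHS_one_eq_sum_normSq`,
  `iter_blockAvg_one`, `corr_expMeanLogSU_one`, ★ `trueLinStep_one_eq_linAvg` (the true linearised (0.4)-step at the flat tower IS `linAvg`).
* §2 ★★ `flat_core_curl_div_of_kerQ_T3` — for ANY `linAvg`-composite `Q` (`hQ0`, `hQs`) and `Y` with `Q^{(K−n)}Y = 0`:
  `(1∕2)·(ℓ²)⁻¹·Σ_b‖Y b‖² ≤ (18 + 76800L⁴)·(Σ_p Σ_{a,b′}|(curl 1 Y p)_{ab′}|² + Σ_x Σ_{a,b′}|(diverg 1 Y x)_{ab′}|²)` (k- and volume-uniform).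
* §3 ★★★ `hessK_flat_on_SH_T3` — with `Δ(∂^*Y) = 0` off the centres and LEMMA H (constant `C_H`) displayed:
  `(1∕2)·(ℓ²)⁻¹·Σ_b‖Y b‖² ≤ (18 + 76800L⁴)·(1 + C_H·(2 + 2400L⁴∕(√L − 1)²))·Σ_p Σ_{a,b′}|(curl 1 Y p)_{ab′}|²`, i.e. `κ = 1∕(2(18+76800L⁴)(1+ζ_H))`.
* §4 ★★ `hessK_curl_div_on_kerQ_T3` — the κ-ROW at a (14)-regular background `W` in (116)-currency (the same core at `U₀ := W`, full covariant divergence displayed).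
HONEST SCOPE.  Bookkeeping over two landed theorems; no new estimate; `L`-only constants (useless as numbers); LEMMA H displayed (`hH`), not proved.

References: T. Bałaban, CMP 99 (1985) 389–434 [Balaban1985BackgroundPropagators] (Thm 3.11 p.416, (3.3)–(3.8) pp.390–392); CMP 102 (1985) 277–309
[Balaban1985Variational] ((14)–(15) p.280, (116) p.295, Prop. 7 p.299); CMP 95 (1984) 17–40 [Balaban1984PropagatorsI] (Prop. 1.1 (1.90) p.33, (1.2) p.18, (1.21) p.21);
CMP 98 (1985) 17–51 [Balaban1985Averaging] ((124)–(125) p.36); CMP 109 (1987) 249–301 [Balaban1987RG1] ((0.4) p.253).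
-/

set_option autoImplicit false

noncomputable section

open scoped BigOperators Matrix.Norms.L2Operator Matrix

namespace Summit.QuantumFields.YangMills.Theorems.Prop7FlatHessKOnSlice

open Literature.MathematicalPhysics.QuantumFieldTheory.Balaban1983to89
open Literature.MathematicalPhysics.QuantumFieldTheory.Balaban1983to89.T3ContinuumYM3Torus
open Finset T4Continuum BlockAveraging AveragingRT ExpMeanLog BlockAveragingEMLLinearised BlockAveragingEMLLinearisedBackground LatticeFieldCalculus
open B9Eq39Adjoint (divB)
open B10Eq27TorusAxialLog (unitsField toUField)
open B9TorusCalculus (torusT)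
open B15DeterminingSets (embIter)
open Summit.QuantumFields.YangMills.Theorems.Prop7CurvedLandauCoreLinearSubspaceT3 (linearised_subspace_core_budget_T3)
open Summit.QuantumFields.YangMills.Theorems.Prop7CentreHarmonicDivEngine (sum_diverg_normSq_le_curl_normSq_of_centreHarmonic_T3)

/-! ## §1 The flat dictionary -/

section Dictionary

variable {P : Params}

/-- The trivial `SU(2)` configuration read in the units of `M₂(ℂ)` is `1`. [cite: Balaban1985Averaging, (19) p.21] -/
theorem unitsField_toUField_one (b : PBond P 0) :
    unitsField (toUField (1 : GaugeField P 0 (Matrix.specialUnitaryGroup (Fin 2) ℂ))) b = 1 := by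
  apply Units.ext
  rw [B10Eq27TorusAxialLog.val_unitsField, Units.val_one]
  rfl

/-- **AT THE FLAT BACKGROUND THE COVARIANT CURL (3.4) IS `LatticeFieldCalculus.curl 1`** on the positively oriented plaquette `⟨x; μ < ν⟩`.
[cite: Balaban1985BackgroundPropagators, (3.4) p.391; Balaban1984PropagatorsI, (1.2) p.18] -/
theorem curl_torusT_one_eq (Y : PBond P 0 → Matrix (Fin 2) (Fin 2) ℂ) {μ ν : Fin P.d} (h : μ < ν) (x : Site P 0) :
    B9Eq39Adjoint.curl (torusT P 0) (fun κ z => unitsField (toUField (1 : GaugeField P 0 (Matrix.specialUnitaryGroup (Fin 2) ℂ))) ⟨z, κ⟩)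
        (fun κ z => Y ⟨z, κ⟩) μ ν x = curl 1 Y ⟨x, μ, ν, h⟩ := by
  simp only [B9Eq39Adjoint.curl, B9Eq39Adjoint.covD, unitsField_toUField_one, B9Eq39Adjoint.R_one, B9TorusCalculus.torusT_apply,
    LatticeFieldCalculus.curl, one_smul]
  abel

/-- **AT THE FLAT BACKGROUND THE COVARIANT DIVERGENCE (3.8) IS `LatticeFieldCalculus.diverg 1`**. [cite: Balaban1985BackgroundPropagators, (3.8) p.392; Balaban1984PropagatorsI, (1.21) p.21] -/
theorem divB_torusT_one_eq (Y : PBond P 0 → Matrix (Fin 2) (Fin 2) ℂ) (x : Site P 0) :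
    divB (torusT P 0) (fun κ z => unitsField (toUField (1 : GaugeField P 0 (Matrix.specialUnitaryGroup (Fin 2) ℂ))) ⟨z, κ⟩)
        (fun κ z => Y ⟨z, κ⟩) x = diverg 1 Y x := by
  simp only [B9Eq39Adjoint.divB, B9Eq39Adjoint.covDstar, unitsField_toUField_one, inv_one, B9Eq39Adjoint.R_one,
    B9TorusCalculus.torusT_symm_apply, LatticeFieldCalculus.diverg, one_smul]

/-- **THE HS CURL SUM OF THE CORE AT `W = 1` IS THE FROBENIUS CURL SUM OVER `Plaq`**: `Σ_x Σ_{μ<ν} Σ_{jk}|(D_1 Y)(p_{μν}(x))_{jk}|² = Σ_p Σ_{ab′}|(curl 1 Y p)_{ab′}|²`.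
[cite: Balaban1985BackgroundPropagators, (3.10) p.392; Balaban1984PropagatorsI, (1.2) p.18] -/
theorem sum_curlHS_one_eq_sum_plaq_normSq (Y : PBond P 0 → Matrix (Fin 2) (Fin 2) ℂ) :
    (∑ x : Site P 0, ∑ μ : Fin P.d, ∑ ν : Fin P.d,
        (if μ < ν then ∑ j : Fin 2, ∑ k : Fin 2,
          ‖(B9Eq39Adjoint.curl (torusT P 0) (fun κ z => unitsField (toUField (1 : GaugeField P 0 (Matrix.specialUnitaryGroup (Fin 2) ℂ))) ⟨z, κ⟩)
              (fun κ z => Y ⟨z, κ⟩) μ ν x) j k‖ ^ 2 else 0))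
      = ∑ p : Plaq P 0, ∑ a : Fin 2, ∑ b' : Fin 2, Complex.normSq ((curl 1 Y p) a b') := by
  rw [Node00.sum_plaq_eq_sum_site]
  refine Finset.sum_congr rfl fun x _ => Finset.sum_congr rfl fun μ _ => Finset.sum_congr rfl fun ν _ => ?_
  by_cases h : μ < ν
  · rw [if_pos h, dif_pos h]
    refine Finset.sum_congr rfl fun j _ => Finset.sum_congr rfl fun k _ => ?_
    rw [curl_torusT_one_eq Y h x, Complex.normSq_eq_norm_sq]
  · rw [if_neg h, dif_neg h]

/-- **THE HS DIVERGENCE SUM OF THE CORE AT `W = 1` IS THE FROBENIUS DIVERGENCE SUM**: `Σ_x Σ_{jk}|(D^*_1 Y)(x)_{jk}|² = Σ_x Σ_{ab′}|(diverg 1 Y x)_{ab′}|²`.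
[cite: Balaban1985BackgroundPropagators, (3.8) p.392; Balaban1984PropagatorsI, (1.21) p.21] -/
theorem sum_divBHS_one_eq_sum_normSq (Y : PBond P 0 → Matrix (Fin 2) (Fin 2) ℂ) :
    (∑ x : Site P 0, ∑ j : Fin 2, ∑ k : Fin 2,
        ‖(divB (torusT P 0) (fun κ z => unitsField (toUField (1 : GaugeField P 0 (Matrix.specialUnitaryGroup (Fin 2) ℂ))) ⟨z, κ⟩)
            (fun κ z => Y ⟨z, κ⟩) x) j k‖ ^ 2)
      = ∑ x : Site P 0, ∑ a : Fin 2, ∑ b' : Fin 2, Complex.normSq ((diverg 1 Y x) a b') := by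
  refine Finset.sum_congr rfl fun x _ => Finset.sum_congr rfl fun j _ => Finset.sum_congr rfl fun k _ => ?_
  rw [divB_torusT_one_eq Y x, Complex.normSq_eq_norm_sq]

/-- The trivial configuration is a fixed point of the iterated (0.4) averaging of record (`avgFun_one` ∘ `expMeanLogSU_E_one`). [cite: Balaban1987RG1, (0.4) p.253] -/
theorem iter_blockAvg_one : ∀ k : ℕ,
    Averaging.iter (fun i => blockAvg (P := P) (j := i) (expMeanLogSU (n := Fin 2))) k
        (1 : GaugeField P 0 (Matrix.specialUnitaryGroup (Fin 2) ℂ)) = 1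
  | 0 => rfl
  | k + 1 => by
    show (blockAvg (expMeanLogSU (n := Fin 2))).avg
        (Averaging.iter (fun i => blockAvg (P := P) (j := i) (expMeanLogSU (n := Fin 2))) k
          (1 : GaugeField P 0 (Matrix.specialUnitaryGroup (Fin 2) ℂ))) = 1
    rw [iter_blockAvg_one k, blockAvg_avg]
    exact T3DescentFibreTower.avgFun_one (expMeanLogSU (n := Fin 2)) T3DescentFibreTower.expMeanLogSU_E_one

/-- The (0.4) correction factor of the trivial configuration is `1` (`Ū = corr·(axial average)`, both trivial at `U = 1`). [cite: Balaban1987RG1, (0.4) p.253] -/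
theorem corr_expMeanLogSU_one {j : ℕ} (c : PBond P (j + 1)) :
    corr (expMeanLogSU (n := Fin 2)) (1 : GaugeField P j (Matrix.specialUnitaryGroup (Fin 2) ℂ)) c = 1 := by
  have h := congrFun (T3DescentFibreTower.avgFun_one (P := P) (j := j) (expMeanLogSU (n := Fin 2))
    T3DescentFibreTower.expMeanLogSU_E_one) c
  have hax := congrFun (T3DescentFibreTower.axialAvg_one (P := P) (j := j) (G := Matrix.specialUnitaryGroup (Fin 2) ℂ)) c
  change corr (expMeanLogSU (n := Fin 2)) (1 : GaugeField P j (Matrix.specialUnitaryGroup (Fin 2) ℂ)) c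
      * axialAvg (1 : GaugeField P j (Matrix.specialUnitaryGroup (Fin 2) ℂ)) c = (1 : GaugeField P (j + 1) _) c at h
  rw [hax] at h
  simpa using h

/-- ★ **THE TRUE LINEARISED (0.4)-STEP AT THE FLAT TOWER IS THE TREE'S `linAvg`**: with `Ū₀^{(k)} = 1` (`U₀ = 1`), all loop variables and the correction factor are `1`,
`D(exp∘mean∘log)(1) = mean` (`hasFDerivAt_eml_one`), covariant signed sums are plain signed sums (`covWalkSum_one`), and «mean of the loop sums + the axial sum» is
`linAvg` (the loop word `Γ ∪ [x,x′] ∪ (−Γ′) ∪ (−c)` plus `c` is the three-segment sum; `covWalkSum_loop_eq` at `1`). [cite: Balaban1985Averaging, (124)-(125) p.36; Balaban1987RG1, (0.4) p.253] -/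
theorem trueLinStep_one_eq_linAvg (k : ℕ) (Z : PBond P k → Matrix (Fin 2) (Fin 2) ℂ) (c : PBond P (k + 1)) :
    fderiv ℂ (eml : (Idx P → Matrix (Fin 2) (Fin 2) ℂ) → Matrix (Fin 2) (Fin 2) ℂ)
          (fun i => ((loopHol (Averaging.iter (fun i => blockAvg (P := P) (j := i) (expMeanLogSU (n := Fin 2))) k
              (1 : GaugeField P 0 (Matrix.specialUnitaryGroup (Fin 2) ℂ))) c i : Matrix.specialUnitaryGroup (Fin 2) ℂ) : Matrix (Fin 2) (Fin 2) ℂ))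
          (fun i => covWalkSum (Averaging.iter (fun i => blockAvg (P := P) (j := i) (expMeanLogSU (n := Fin 2))) k
              (1 : GaugeField P 0 (Matrix.specialUnitaryGroup (Fin 2) ℂ))) Z (walk (emb c.src) (loopWord P.L c.dir (off i.1) i.2.1 i.2.2))
            * ((loopHol (Averaging.iter (fun i => blockAvg (P := P) (j := i) (expMeanLogSU (n := Fin 2))) k
              (1 : GaugeField P 0 (Matrix.specialUnitaryGroup (Fin 2) ℂ))) c i : Matrix.specialUnitaryGroup (Fin 2) ℂ) : Matrix (Fin 2) (Fin 2) ℂ))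
          * star ((corr (expMeanLogSU (n := Fin 2)) (Averaging.iter (fun i => blockAvg (P := P) (j := i) (expMeanLogSU (n := Fin 2))) k
              (1 : GaugeField P 0 (Matrix.specialUnitaryGroup (Fin 2) ℂ))) c : Matrix.specialUnitaryGroup (Fin 2) ℂ) : Matrix (Fin 2) (Fin 2) ℂ)
        + ((corr (expMeanLogSU (n := Fin 2)) (Averaging.iter (fun i => blockAvg (P := P) (j := i) (expMeanLogSU (n := Fin 2))) k
              (1 : GaugeField P 0 (Matrix.specialUnitaryGroup (Fin 2) ℂ))) c : Matrix.specialUnitaryGroup (Fin 2) ℂ) : Matrix (Fin 2) (Fin 2) ℂ)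
          * covWalkSum (Averaging.iter (fun i => blockAvg (P := P) (j := i) (expMeanLogSU (n := Fin 2))) k
              (1 : GaugeField P 0 (Matrix.specialUnitaryGroup (Fin 2) ℂ))) Z (walk (emb c.src) (List.replicate P.L (c.dir, true)))
          * star ((corr (expMeanLogSU (n := Fin 2)) (Averaging.iter (fun i => blockAvg (P := P) (j := i) (expMeanLogSU (n := Fin 2))) k
              (1 : GaugeField P 0 (Matrix.specialUnitaryGroup (Fin 2) ℂ))) c : Matrix.specialUnitaryGroup (Fin 2) ℂ) : Matrix (Fin 2) (Fin 2) ℂ)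
      = linAvg Z c := by
  rw [iter_blockAvg_one k]
  have hl : ∀ i : Idx P, loopHol (1 : GaugeField P k (Matrix.specialUnitaryGroup (Fin 2) ℂ)) c i = 1 :=
    fun i => T3DescentFibreTower.loopHol_one c i
  simp only [hl, corr_expMeanLogSU_one, OneMemClass.coe_one, mul_one, star_one, one_mul, covWalkSum_one]
  have hfd : fderiv ℂ (eml : (Idx P → Matrix (Fin 2) (Fin 2) ℂ) → Matrix (Fin 2) (Fin 2) ℂ) (fun _ => (1 : Matrix (Fin 2) (Fin 2) ℂ))
      = B7TransferAnalyticMean.meanCLM (Idx P) (Matrix (Fin 2) (Fin 2) ℂ) :=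
    (BlockAveragingEMLAnalyticMean.hasFDerivAt_eml_one (ι := Idx P) (𝔸 := Matrix (Fin 2) (Fin 2) ℂ)).fderiv
  rw [hfd, B7TransferAnalyticMean.meanCLM_apply]
  -- mean of the loop sums plus the axial sum is `linAvg` (the three-segment rearrangement, `covWalkSum_loop_eq` at `1`)
  have hc : (Fintype.card (Idx P) : ℂ) ≠ 0 := Nat.cast_ne_zero.mpr Fintype.card_ne_zero
  have hterm : ∀ i : Idx P, walkSum Z (walk (emb c.src) (loopWord P.L c.dir (off i.1) i.2.1 i.2.2)) =
      (walkSum Z (walk (emb c.src) (stairWord i.2.1 (off i.1))) +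
        walkSum Z (walk (walkEnd (emb c.src) (stairWord i.2.1 (off i.1))) (List.replicate P.L (c.dir, true))) -
        walkSum Z (walk (emb c.tgt) (stairWord i.2.2 (off i.1)))) - walkSum Z (walk (emb c.src) (List.replicate P.L (c.dir, true))) := by
    intro i
    have h := covWalkSum_loop_eq (1 : GaugeField P k (Matrix.specialUnitaryGroup (Fin 2) ℂ)) Z c i
    simp only [covWalkSum_one, hl, T3DescentFibreTower.holAt_one, mul_one, inv_one, OneMemClass.coe_one, star_one, one_mul,
      sub_self, add_zero] at h
    rw [← h, add_sub_cancel_right]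
  rw [linAvg_def]
  simp only [hterm, Finset.sum_sub_distrib, Finset.sum_const, Finset.card_univ, smul_sub]
  rw [← Nat.cast_smul_eq_nsmul ℂ, smul_smul, inv_mul_cancel₀ hc, one_smul, sub_add_cancel]

end Dictionary

/-! ## §2 The flat linearised core on `ker Q` in the letters of `LatticeFieldCalculus` -/

section Core

/-- ★★ **THE FLAT (116)-CURRENCY CORE ON `ker Q^{(K−n)}`** (`d = 3`, `SU(2)`-letters `M₂(ℂ)`, run `K`, comparison height `n`, `ℓ = L^{K−n}`): for ANY composite `Q` of the
tree's linearised (0.4) average (`Q 0 = id`, `Q (i+1) Y c = linAvg (Q i Y) c`) and every bond field `Y` with `Q^{(K−n)}Y = 0`,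
`(1∕2)·(ℓ²)⁻¹·Σ_b‖Y(b)‖² ≤ (18 + 76800L⁴)·(Σ_p Σ_{ab′}|(curl 1 Y p)_{ab′}|² + Σ_x Σ_{ab′}|(diverg 1 Y x)_{ab′}|²)` — FULL divergence, no `ℓ³`, k- and volume-uniform
(✓`linearised_subspace_core_budget_T3` at `U₀ = 1`, `ε = (2·10¹³L⁹)⁻¹`, `δ = 0`, `Z = DIV`, `Z_Q = 0`, through §1).
[cite: Balaban1985BackgroundPropagators, Thm 3.11 p.416; Balaban1984PropagatorsI, Prop. 1.1 (1.90) p.33; Balaban1985Variational, (116) p.295, Prop. 7 p.299] -/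
theorem flat_core_curl_div_of_kerQ_T3 (F : T3Family) (n K : ℕ)
    (Q : (i : ℕ) → (PBond (F.P K) 0 → Matrix (Fin 2) (Fin 2) ℂ) → PBond (F.P K) i → Matrix (Fin 2) (Fin 2) ℂ)
    (hQ0 : ∀ Y, Q 0 Y = Y)
    (hQs : ∀ (i : ℕ) (Y : PBond (F.P K) 0 → Matrix (Fin 2) (Fin 2) ℂ) (c : PBond (F.P K) (i + 1)), Q (i + 1) Y c = linAvg (Q i Y) c)
    (Y : PBond (F.P K) 0 → Matrix (Fin 2) (Fin 2) ℂ) (hQY : ∀ c : PBond (F.P K) (K - n), Q (K - n) Y c = 0) :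
    (1 / 2) * ((((F.L : ℝ) ^ (K - n))) ^ 2)⁻¹ * (∑ b : PBond (F.P K) 0, ‖Y b‖ ^ 2)
      ≤ (18 + 76800 * (F.L : ℝ) ^ 4) *
        ((∑ p : Plaq (F.P K) 0, ∑ a : Fin 2, ∑ b' : Fin 2, Complex.normSq ((curl 1 Y p) a b'))
          + ∑ x : Site (F.P K) 0, ∑ a : Fin 2, ∑ b' : Fin 2, Complex.normSq ((diverg 1 Y x) a b')) := by
  have hL1 : (1 : ℝ) < F.L := by exact_mod_cast F.hL.2
  have hL0 : (0 : ℝ) < F.L := by linarith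
  set ε : ℝ := (20000000000000 * (F.L : ℝ) ^ 9)⁻¹ with hε_def
  have hε : 0 < ε := by rw [hε_def]; positivity
  have hεL : 20000000000000 * (F.L : ℝ) ^ 9 * ε ≤ 1 := by
    rw [hε_def, mul_inv_cancel₀ (by positivity)]
  have hU : ∀ p : Plaq (F.P K) 0, dist1 (GaugeField.plaqHol (1 : GaugeField (F.P K) 0 (Matrix.specialUnitaryGroup (Fin 2) ℂ)) p)
      ≤ ε * (((F.L : ℝ) ^ (K - n)) ^ 2)⁻¹ := by
    intro p
    have h1 : GaugeField.plaqHol (1 : GaugeField (F.P K) 0 (Matrix.specialUnitaryGroup (Fin 2) ℂ)) p = 1 := by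
      simp [GaugeField.plaqHol, show ∀ b, (1 : GaugeField (F.P K) 0 (Matrix.specialUnitaryGroup (Fin 2) ℂ)) b = 1 from fun _ => rfl]
    rw [h1, GaugeGroup.dist1_one]
    positivity
  -- the `linAvg`-composite satisfies the TRUE linearised recursion at the flat tower (§1)
  have hQs' : ∀ (k : ℕ) (Y : PBond (F.P K) 0 → Matrix (Fin 2) (Fin 2) ℂ) (c : PBond (F.P K) (k + 1)), Q (k + 1) Y c
      = (fderiv ℂ (eml : (Idx (F.P K) → Matrix (Fin 2) (Fin 2) ℂ) → Matrix (Fin 2) (Fin 2) ℂ)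
            (fun i => ((loopHol (Averaging.iter (fun i => blockAvg (P := (F.P K)) (j := i) (expMeanLogSU (n := Fin 2))) k
              (1 : GaugeField (F.P K) 0 (Matrix.specialUnitaryGroup (Fin 2) ℂ))) c i : Matrix.specialUnitaryGroup (Fin 2) ℂ) : Matrix (Fin 2) (Fin 2) ℂ))
            (fun i => covWalkSum (Averaging.iter (fun i => blockAvg (P := (F.P K)) (j := i) (expMeanLogSU (n := Fin 2))) k
              (1 : GaugeField (F.P K) 0 (Matrix.specialUnitaryGroup (Fin 2) ℂ))) (Q k Y) (walk (emb c.src) (loopWord (F.P K).L c.dir (off i.1) i.2.1 i.2.2))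
              * ((loopHol (Averaging.iter (fun i => blockAvg (P := (F.P K)) (j := i) (expMeanLogSU (n := Fin 2))) k
                (1 : GaugeField (F.P K) 0 (Matrix.specialUnitaryGroup (Fin 2) ℂ))) c i : Matrix.specialUnitaryGroup (Fin 2) ℂ) : Matrix (Fin 2) (Fin 2) ℂ))
            * star ((corr (expMeanLogSU (n := Fin 2)) (Averaging.iter (fun i => blockAvg (P := (F.P K)) (j := i) (expMeanLogSU (n := Fin 2))) k
                (1 : GaugeField (F.P K) 0 (Matrix.specialUnitaryGroup (Fin 2) ℂ))) c : Matrix.specialUnitaryGroup (Fin 2) ℂ) : Matrix (Fin 2) (Fin 2) ℂ)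
          + ((corr (expMeanLogSU (n := Fin 2)) (Averaging.iter (fun i => blockAvg (P := (F.P K)) (j := i) (expMeanLogSU (n := Fin 2))) k
                (1 : GaugeField (F.P K) 0 (Matrix.specialUnitaryGroup (Fin 2) ℂ))) c : Matrix.specialUnitaryGroup (Fin 2) ℂ) : Matrix (Fin 2) (Fin 2) ℂ)
            * covWalkSum (Averaging.iter (fun i => blockAvg (P := (F.P K)) (j := i) (expMeanLogSU (n := Fin 2))) k
                (1 : GaugeField (F.P K) 0 (Matrix.specialUnitaryGroup (Fin 2) ℂ))) (Q k Y) (walk (emb c.src) (List.replicate (F.P K).L (c.dir, true)))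
            * star ((corr (expMeanLogSU (n := Fin 2)) (Averaging.iter (fun i => blockAvg (P := (F.P K)) (j := i) (expMeanLogSU (n := Fin 2))) k
                (1 : GaugeField (F.P K) 0 (Matrix.specialUnitaryGroup (Fin 2) ℂ))) c : Matrix.specialUnitaryGroup (Fin 2) ℂ) : Matrix (Fin 2) (Fin 2) ℂ)) := by
    intro k Y c
    rw [trueLinStep_one_eq_linAvg k (Q k Y) c, hQs]
  -- divergence budget `δ = 0`, `Z = DIV`; constraint budget `Z_Q = 0`
  have hdivB : (∑ x : Site (F.P K) 0, ∑ j : Fin 2, ∑ k : Fin 2,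
        ‖(divB (torusT (F.P K) 0) (fun κ z => unitsField (toUField (1 : GaugeField (F.P K) 0 (Matrix.specialUnitaryGroup (Fin 2) ℂ))) ⟨z, κ⟩)
            (fun κ z => Y ⟨z, κ⟩) x) j k‖ ^ 2)
      ≤ 0 * (∑ b : PBond (F.P K) 0, ‖Y b‖ ^ 2)
        + ∑ x : Site (F.P K) 0, ∑ a : Fin 2, ∑ b' : Fin 2, Complex.normSq ((diverg 1 Y x) a b') := by
    rw [zero_mul, zero_add, sum_divBHS_one_eq_sum_normSq]
  have hq0 : ∑ c : PBond (F.P K) (K - n), ‖Q (K - n) Y c‖ ^ 2 ≤ 0 := by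
    rw [Finset.sum_eq_zero fun c _ => by rw [hQY c, norm_zero, zero_pow two_ne_zero]]
  have h := linearised_subspace_core_budget_T3 F n K 1 hε hεL hU Q hQ0 hQs' Y hdivB hq0
  rw [sum_curlHS_one_eq_sum_plaq_normSq] at h
  have hA : 0 ≤ (18 + 76800 * (F.L : ℝ) ^ 4) := by positivity
  nlinarith [h, hA]

end Core

/-! ## §3 The flat HESS-K on `V = S_H ∩ ker Q`, LEMMA H displayed -/

section HessK

/-- ★★★ **THE FLAT HESS-K ON `V = S_H ∩ ker Q` AT `W = 1`** (`d = 3`, `SU(2)`-letters, run `K`, comparison height `n`, `ℓ = L^{K−n}`): for ANY `linAvg`-composite `Q` and every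
bond field `Y` with `Q^{(K−n)}Y = 0` and `Δ(∂^*Y) = 0` off the `(K−n)`-centres (the `DIV`-optimal representative inside the pinned group), GIVEN LEMMA H with constant `C_H`
(displayed exactly as in ✓`Prop7CentreHarmonicDivEngine.sum_diverg_normSq_le_curl_normSq_of_centreHarmonic_T3`),
`(1∕2)·(ℓ²)⁻¹·Σ_b‖Y(b)‖² ≤ (18 + 76800L⁴)·(1 + C_H·(2 + 2400L⁴∕(√L − 1)²))·Σ_p Σ_{ab′}|(curl 1 Y p)_{ab′}|²` — the HKGK line's `κ = 1∕(2(18 + 76800L⁴)(1 + ζ_H))`,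
`ζ_H = C_H(2 + 2400L⁴∕(√L−1)²)`, uniform in `k = K − n` and in the volume.
[cite: Balaban1985BackgroundPropagators, Thm 3.11 p.416; Balaban1984PropagatorsI, Prop. 1.1 (1.90) p.33; Balaban1985Variational, (116) p.295, Prop. 7 p.299] -/
theorem hessK_flat_on_SH_T3 (F : T3Family) (n K : ℕ)
    (Q : (i : ℕ) → (PBond (F.P K) 0 → Matrix (Fin 2) (Fin 2) ℂ) → PBond (F.P K) i → Matrix (Fin 2) (Fin 2) ℂ)
    (hQ0 : ∀ Y, Q 0 Y = Y)
    (hQs : ∀ (i : ℕ) (Y : PBond (F.P K) 0 → Matrix (Fin 2) (Fin 2) ℂ) (c : PBond (F.P K) (i + 1)), Q (i + 1) Y c = linAvg (Q i Y) c)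
    (Y : PBond (F.P K) 0 → Matrix (Fin 2) (Fin 2) ℂ) (hQY : ∀ c : PBond (F.P K) (K - n), Q (K - n) Y c = 0)
    (hSH : ∀ x : Site (F.P K) 0, x ∉ Set.range (embIter (K - n)) → laplace 1 (diverg 1 Y) x = 0)
    {CH : ℝ} (hCH : 0 ≤ CH)
    (hH : ∀ ψ : SiteField (F.P K) 0 ℝ, (∀ x : Site (F.P K) 0, x ∉ Set.range (embIter (K - n)) → laplace 1 (laplace 1 ψ) x = 0) →
      (F.L : ℝ) ^ (K - n) * ∑ x : Site (F.P K) 0, laplace 1 ψ x ^ 2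
        ≤ CH * ∑ c : PBond (F.P K) (K - n), (ψ (embIter (K - n) c.tgt) - ψ (embIter (K - n) c.src)) ^ 2) :
    (1 / 2) * ((((F.L : ℝ) ^ (K - n))) ^ 2)⁻¹ * (∑ b : PBond (F.P K) 0, ‖Y b‖ ^ 2)
      ≤ (18 + 76800 * (F.L : ℝ) ^ 4) * (1 + CH * (2 + 2400 * (F.L : ℝ) ^ 4 / (Real.sqrt F.L - 1) ^ 2))
          * ∑ p : Plaq (F.P K) 0, ∑ a : Fin 2, ∑ b' : Fin 2, Complex.normSq ((curl 1 Y p) a b') := by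
  have hcore := flat_core_curl_div_of_kerQ_T3 F n K Q hQ0 hQs Y hQY
  have hζ := sum_diverg_normSq_le_curl_normSq_of_centreHarmonic_T3 F K n (N := 2) Q hQ0 hQs Y hQY hSH hCH hH
  have h2400 : CH * (2 + 600 * ((2 : ℕ) : ℝ) ^ 2 * (F.L : ℝ) ^ 4 / (Real.sqrt F.L - 1) ^ 2)
      = CH * (2 + 2400 * (F.L : ℝ) ^ 4 / (Real.sqrt F.L - 1) ^ 2) := by
    norm_num
  rw [h2400] at hζ
  have hA : 0 ≤ (18 + 76800 * (F.L : ℝ) ^ 4) := by positivity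
  have hK0 : 0 ≤ ∑ p : Plaq (F.P K) 0, ∑ a : Fin 2, ∑ b' : Fin 2, Complex.normSq ((curl 1 Y p) a b') :=
    Finset.sum_nonneg fun _ _ => Finset.sum_nonneg fun _ _ => Finset.sum_nonneg fun _ _ => Complex.normSq_nonneg _
  calc (1 / 2) * ((((F.L : ℝ) ^ (K - n))) ^ 2)⁻¹ * (∑ b : PBond (F.P K) 0, ‖Y b‖ ^ 2)
      ≤ (18 + 76800 * (F.L : ℝ) ^ 4) *
        ((∑ p : Plaq (F.P K) 0, ∑ a : Fin 2, ∑ b' : Fin 2, Complex.normSq ((curl 1 Y p) a b'))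
          + ∑ x : Site (F.P K) 0, ∑ a : Fin 2, ∑ b' : Fin 2, Complex.normSq ((diverg 1 Y x) a b')) := hcore
    _ ≤ (18 + 76800 * (F.L : ℝ) ^ 4) *
        ((∑ p : Plaq (F.P K) 0, ∑ a : Fin 2, ∑ b' : Fin 2, Complex.normSq ((curl 1 Y p) a b'))
          + CH * (2 + 2400 * (F.L : ℝ) ^ 4 / (Real.sqrt F.L - 1) ^ 2)
            * ∑ p : Plaq (F.P K) 0, ∑ a : Fin 2, ∑ b' : Fin 2, Complex.normSq ((curl 1 Y p) a b')) :=
        mul_le_mul_of_nonneg_left (by linarith [hζ]) hA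
    _ = (18 + 76800 * (F.L : ℝ) ^ 4) * (1 + CH * (2 + 2400 * (F.L : ℝ) ^ 4 / (Real.sqrt F.L - 1) ^ 2))
          * ∑ p : Plaq (F.P K) 0, ∑ a : Fin 2, ∑ b' : Fin 2, Complex.normSq ((curl 1 Y p) a b') := by ring

end HessK

/-! ## §4 The curved κ-row in (116)-currency: the same core at a (14)-regular background `W` -/

section Curved

/-- ★★ **THE κ-ROW AT A (14)-REGULAR BACKGROUND IN (116)-CURRENCY** (★w4-19200 g7's R1-SLOW design 2026-08-28 23:02∕23:05Z: `R1-SLOW ⟸ (ℛ-ROW) ∧ (κ-ROW)`): `W` with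
`dist1(W(∂p)) ≤ ε·ℓ⁻²` (`2·10¹³L⁹ε ≤ 1`), `Q` the TRUE linearised recursion of record at `W` (displayed; zero content, ✓`exists_trueLinIter_family`), `Y` any bond field with
`Q^{(K−n)}Y = 0`.  THEN `(1∕2)·(ℓ²)⁻¹·Σ_b‖Y(b)‖² ≤ (18 + 76800L⁴)·(Σ_{x,μ<ν}‖curl_W Y‖²_HS + Σ_x‖D^*_W Y‖²_HS)` — HESS-K on `V_W` with the FULL covariant divergence displayed at
coefficient one (✓`linearised_subspace_core_budget_T3` at `δ := 0`, `Z := DIV_W`, `Z_Q := 0`); k- and volume-uniform; §2 is its reading at `W = 1`.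
[cite: Balaban1985BackgroundPropagators, Thm 3.11 p.416; Balaban1985Variational, (14)-(15) p.280, (116) p.295, Prop. 7 p.299] -/
theorem hessK_curl_div_on_kerQ_T3 (F : T3Family) (n K : ℕ)
    (W : GaugeField (F.P K) 0 (Matrix.specialUnitaryGroup (Fin 2) ℂ)) {ε : ℝ} (hε : 0 < ε) (hεL : 20000000000000 * (F.L : ℝ) ^ 9 * ε ≤ 1)
    (hU : ∀ p : Plaq (F.P K) 0, dist1 (GaugeField.plaqHol W p) ≤ ε * (((F.L : ℝ) ^ (K - n)) ^ 2)⁻¹)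
    (Q : (k : ℕ) → (PBond (F.P K) 0 → Matrix (Fin 2) (Fin 2) ℂ) → PBond (F.P K) k → Matrix (Fin 2) (Fin 2) ℂ) (hQ0 : ∀ Y, Q 0 Y = Y)
    (hQs : ∀ (k : ℕ) (Y : PBond (F.P K) 0 → Matrix (Fin 2) (Fin 2) ℂ) (c : PBond (F.P K) (k + 1)), Q (k + 1) Y c
      = (fderiv ℂ (eml : (Idx (F.P K) → Matrix (Fin 2) (Fin 2) ℂ) → Matrix (Fin 2) (Fin 2) ℂ)
            (fun i => ((loopHol (Averaging.iter (fun i => blockAvg (P := (F.P K)) (j := i) (expMeanLogSU (n := Fin 2))) k W) c i : Matrix.specialUnitaryGroup (Fin 2) ℂ) : Matrix (Fin 2) (Fin 2) ℂ))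
            (fun i => covWalkSum (Averaging.iter (fun i => blockAvg (P := (F.P K)) (j := i) (expMeanLogSU (n := Fin 2))) k W) (Q k Y) (walk (emb c.src) (loopWord (F.P K).L c.dir (off i.1) i.2.1 i.2.2))
              * ((loopHol (Averaging.iter (fun i => blockAvg (P := (F.P K)) (j := i) (expMeanLogSU (n := Fin 2))) k W) c i : Matrix.specialUnitaryGroup (Fin 2) ℂ) : Matrix (Fin 2) (Fin 2) ℂ))
            * star ((corr (expMeanLogSU (n := Fin 2)) (Averaging.iter (fun i => blockAvg (P := (F.P K)) (j := i) (expMeanLogSU (n := Fin 2))) k W) c : Matrix.specialUnitaryGroup (Fin 2) ℂ) : Matrix (Fin 2) (Fin 2) ℂ)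
          + ((corr (expMeanLogSU (n := Fin 2)) (Averaging.iter (fun i => blockAvg (P := (F.P K)) (j := i) (expMeanLogSU (n := Fin 2))) k W) c : Matrix.specialUnitaryGroup (Fin 2) ℂ) : Matrix (Fin 2) (Fin 2) ℂ)
            * covWalkSum (Averaging.iter (fun i => blockAvg (P := (F.P K)) (j := i) (expMeanLogSU (n := Fin 2))) k W) (Q k Y) (walk (emb c.src) (List.replicate (F.P K).L (c.dir, true)))
            * star ((corr (expMeanLogSU (n := Fin 2)) (Averaging.iter (fun i => blockAvg (P := (F.P K)) (j := i) (expMeanLogSU (n := Fin 2))) k W) c : Matrix.specialUnitaryGroup (Fin 2) ℂ) : Matrix (Fin 2) (Fin 2) ℂ)))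
    (Y : PBond (F.P K) 0 → Matrix (Fin 2) (Fin 2) ℂ) (hQY : ∀ c : PBond (F.P K) (K - n), Q (K - n) Y c = 0) :
    (1 / 2) * ((((F.L : ℝ) ^ (K - n))) ^ 2)⁻¹ * (∑ b : PBond (F.P K) 0, ‖Y b‖ ^ 2)
      ≤ (18 + 76800 * (F.L : ℝ) ^ 4) *
        ((∑ x : Site (F.P K) 0, ∑ μ : Fin (F.P K).d, ∑ ν : Fin (F.P K).d,
            (if μ < ν then ∑ j : Fin 2, ∑ k : Fin 2,
              ‖(B9Eq39Adjoint.curl (torusT (F.P K) 0) (fun κ z => unitsField (toUField W) ⟨z, κ⟩) (fun κ z => Y ⟨z, κ⟩) μ ν x) j k‖ ^ 2 else 0))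
          + ∑ x : Site (F.P K) 0, ∑ j : Fin 2, ∑ k : Fin 2,
              ‖(divB (torusT (F.P K) 0) (fun κ z => unitsField (toUField W) ⟨z, κ⟩) (fun κ z => Y ⟨z, κ⟩) x) j k‖ ^ 2) := by
  have hdivB : (∑ x : Site (F.P K) 0, ∑ j : Fin 2, ∑ k : Fin 2,
        ‖(divB (torusT (F.P K) 0) (fun κ z => unitsField (toUField W) ⟨z, κ⟩) (fun κ z => Y ⟨z, κ⟩) x) j k‖ ^ 2)
      ≤ 0 * (∑ b : PBond (F.P K) 0, ‖Y b‖ ^ 2)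
        + ∑ x : Site (F.P K) 0, ∑ j : Fin 2, ∑ k : Fin 2,
            ‖(divB (torusT (F.P K) 0) (fun κ z => unitsField (toUField W) ⟨z, κ⟩) (fun κ z => Y ⟨z, κ⟩) x) j k‖ ^ 2 := by
    rw [zero_mul, zero_add]
  have hq0 : ∑ c : PBond (F.P K) (K - n), ‖Q (K - n) Y c‖ ^ 2 ≤ 0 := by
    rw [Finset.sum_eq_zero fun c _ => by rw [hQY c, norm_zero, zero_pow two_ne_zero]]
  have h := linearised_subspace_core_budget_T3 F n K W hε hεL hU Q hQ0 hQs Y hdivB hq0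
  have hA : 0 ≤ (18 + 76800 * (F.L : ℝ) ^ 4) := by positivity
  nlinarith [h, hA]

end Curved

/-! ## §5 (v1.1, append-only) The flat HESS-K on `V = S_H ∩ ker Q`, UNCONDITIONAL — LEMMA H discharged by ✓`Prop7CentreHarmonicDivDictionary.hH_of_lemmaH_flat` -/

section Unconditional

/-- ★★★ **THE FLAT HESS-K ON `V = S_H ∩ ker Q` AT `W = 1`, UNCONDITIONAL** (`d = 3`, `SU(2)`-letters, run `K`, comparison height `n`, `ℓ = L^{K−n}`): for ANY `linAvg`-composite
`Q` and every bond field `Y` with `Q^{(K−n)}Y = 0` and `Δ(∂^*Y) = 0` off the `(K−n)`-centres,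
`(1∕2)·(ℓ²)⁻¹·Σ_b‖Y(b)‖² ≤ (18 + 76800L⁴)·(1 + (3π⁴∕4)·(2 + 2400L⁴∕(√L − 1)²))·Σ_p Σ_{ab′}|(curl 1 Y p)_{ab′}|²` — §3 with LEMMA H's constant `C_H = 3π⁴∕4`
SUPPLIED by the dictionary ✓`Prop7CentreHarmonicDivDictionary.hH_of_lemmaH_flat` (★px17 g0 over ★routeR-w3 g5's ✓`lemmaH_flat`): the HKGK line's κ-ROW′ at the flat background
is a THEOREM, `κ = 1∕(2(18 + 76800L⁴)(1 + (3π⁴∕4)(2 + 2400L⁴∕(√L−1)²)))`, uniform in `k = K − n` and in the volume; no displayed row left.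
[cite: Balaban1985BackgroundPropagators, Thm 3.11 p.416; Balaban1984PropagatorsI, Prop. 1.1 (1.90) p.33; Balaban1985Variational, (116) p.295, Prop. 7 p.299] -/
theorem hessK_flat_on_SH_T3_unconditional (F : T3Family) (n K : ℕ)
    (Q : (i : ℕ) → (PBond (F.P K) 0 → Matrix (Fin 2) (Fin 2) ℂ) → PBond (F.P K) i → Matrix (Fin 2) (Fin 2) ℂ)
    (hQ0 : ∀ Y, Q 0 Y = Y)
    (hQs : ∀ (i : ℕ) (Y : PBond (F.P K) 0 → Matrix (Fin 2) (Fin 2) ℂ) (c : PBond (F.P K) (i + 1)), Q (i + 1) Y c = linAvg (Q i Y) c)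
    (Y : PBond (F.P K) 0 → Matrix (Fin 2) (Fin 2) ℂ) (hQY : ∀ c : PBond (F.P K) (K - n), Q (K - n) Y c = 0)
    (hSH : ∀ x : Site (F.P K) 0, x ∉ Set.range (embIter (K - n)) → laplace 1 (diverg 1 Y) x = 0) :
    (1 / 2) * ((((F.L : ℝ) ^ (K - n))) ^ 2)⁻¹ * (∑ b : PBond (F.P K) 0, ‖Y b‖ ^ 2)
      ≤ (18 + 76800 * (F.L : ℝ) ^ 4) * (1 + (3 * Real.pi ^ 4 / 4) * (2 + 2400 * (F.L : ℝ) ^ 4 / (Real.sqrt F.L - 1) ^ 2))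
          * ∑ p : Plaq (F.P K) 0, ∑ a : Fin 2, ∑ b' : Fin 2, Complex.normSq ((curl 1 Y p) a b') := by
  have hk : K - n ≤ (F.P K).m + (F.P K).K := by
    have := F.hm
    show K - n ≤ F.m + K
    omega
  exact hessK_flat_on_SH_T3 F n K Q hQ0 hQs Y hQY hSH (by positivity)
    (fun ψ hψ => Prop7CentreHarmonicDivDictionary.hH_of_lemmaH_flat (T3ContinuumYM3Torus.T3Family.P_d F K) hk ψ hψ)

end Unconditional

end Summit.QuantumFields.YangMills.Theorems.Prop7FlatHessKOnSlice

end
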